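import Mathlib
import Summits.Ventures.HodgeRepro2.T5RecordSatakeDifferentDatum
import Summits.Ventures.HodgeRepro2.T5CyclotomicTwentyOneSatake

/-!
# THE SATAKE CHAIN WITH NUMERALS AT EVERY NON-SPLIT PLACE PRIME TO `4d`, FOR EVERY CM FIELD

Tier-5 support N3 / §G-N4.2 (seat p3, gen 82). Files 313 / 315 make a place `w ∣ v` of `K` with `4d ∉ v` (the
integral datum of file 235) unramified over `K⁺`; when `v` has one prime above it the place therefore STAYS PRIME
(file 236's `map_eq_of_ramificationIdx'_eq_one_of_ncard_primesOver_eq_one`), and file 291's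
`chainNumerals_of_map_eq` reads rows 2, 6–9 / 9′, 11 / 11′ of T5-SATAKE-KERNEL-p3.md with `q = p^{f(v/p)} = N(v)`:

* **`map_eq_of_four_mul_notMem_of_ncard_eq_one`** — `v 𝓞_K = w` at such a place;
* **`chainNumerals_of_four_mul_notMem`** — the chain with numerals at every place `v` of `K⁺` above `p` with `4d ∉ v`
  and one prime above it (good for `H`), for EVERY CM field `K`: cells `gₙ` with `deg Tₙ = (q³ + 1) q^{4n−3}`,
  `T₁ T_{n+2} = T_{n+3} + (q − 1) T_{n+2} + q⁴ T_{n+1}`, `T₁² = T₂ + (q − 1) T₁ + (q⁴ + q) T₀`;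
  **`chainNumerals_of_four_mul_notMem_integral`** — the same for an integral unimodular `H`, no local hypothesis.

§8(d): uses an L-value-free non-vanishing device: NO.
-/

open Matrix NumberField NumberField.IsCMField IsDedekindDomain IsDedekindDomain.HeightOneSpectrum Module Polynomial
  Ideal
open scoped TensorProduct Pointwise
open Summit.Ventures.HodgeRepro2.T5UnitaryGroupForm Summit.Ventures.HodgeRepro2.T5UnitaryHeckeAdjoint
  Summit.Ventures.HodgeRepro2.T5HeckePermutationModule Summit.Ventures.HodgeRepro2.T5HeckeDoubleCoset
  Summit.Ventures.HodgeRepro2.T5RecordHyperspecial Summit.Ventures.HodgeRepro2.T5GlobalLatticeAlmostAll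
  Summit.Ventures.HodgeRepro2.T5FinitePlaceSplitClassification Summit.Ventures.HodgeRepro2.T5RecordSatakeIntrinsic
  Summit.Ventures.HodgeRepro2.T5SplitPlaceUnitaryGroup Summit.Ventures.HodgeRepro2.T5NonSplitPlaceUnitaryGroup
  Summit.Ventures.HodgeRepro2.T5FinitePlaceCM Summit.Ventures.HodgeRepro2.T5StarOfInvolution
  Summit.Ventures.HodgeRepro2.T5CyclotomicSubfieldHeckeCommutative
  Summit.Ventures.HodgeRepro2.T5IntegralGramBadSet Summit.Ventures.HodgeRepro2.T5RecordSatakeDifferent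
  Summit.Ventures.HodgeRepro2.T5CMFieldSquareDatum Summit.Ventures.HodgeRepro2.T5RecordSatakeDifferentDatum
  Summit.Ventures.HodgeRepro2.T5CyclotomicTwentyOneSatake Summit.Ventures.HodgeRepro2.T5SexticRecordSatake

namespace Summit.Ventures.HodgeRepro2.T5RecordSatakeDifferentChain

variable (K : Type*) [Field K] [NumberField K] [IsCMField K]
variable (d : 𝓞 (maximalRealSubfield K)) (x : 𝓞 K)
  (hdx : algebraMap (maximalRealSubfield K) K (algebraMap (𝓞 (maximalRealSubfield K)) (maximalRealSubfield K) d) =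
    (algebraMap (𝓞 K) K x) ^ 2)
  (hx : complexConj K (algebraMap (𝓞 K) K x) ≠ algebraMap (𝓞 K) K x)
variable (p : ℕ) [hp : Fact p.Prime]
variable (v : HeightOneSpectrum (𝓞 (maximalRealSubfield K))) [hv : v.asIdeal.LiesOver (span {(p : ℤ)})]

include hdx hx in
/-- **A place `v` of `K⁺` with `4d ∉ v` and one prime above it stays prime in `K`**: the prime above it is unramified
(file 315) and unique (file 236). -/
theorem map_eq_of_four_mul_notMem_of_ncard_eq_one (hvd : 4 * d ∉ v.asIdeal)
    (h1 : (v.asIdeal.primesOver (𝓞 K)).ncard = 1) :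
    ∃ w : HeightOneSpectrum (𝓞 K),
      Ideal.map (algebraMap (𝓞 (maximalRealSubfield K)) (𝓞 K)) v.asIdeal = w.asIdeal := by
  obtain ⟨P, hP, hPv⟩ := (Ideal.nonempty_primesOver (S := 𝓞 K) v.asIdeal).some
  haveI := hP
  haveI := hPv
  let w : HeightOneSpectrum (𝓞 K) := ⟨P, hP, Ideal.ne_bot_of_liesOver_of_ne_bot v.ne_bot P⟩
  haveI : w.asIdeal.LiesOver v.asIdeal := hPv
  refine ⟨w, map_eq_of_ramificationIdx'_eq_one_of_ncard_primesOver_eq_one K v w ?_ h1⟩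
  exact ramificationIdx'_eq_one_of_liesOver_of_not_dvd_differentIdeal K v w
    (not_dvd_differentIdeal_of_notMem K d x hdx hx w (by rw [← hPv.over]; exact hvd))

include hdx hx hv in
/-- **THE SATAKE CHAIN WITH NUMERALS AT EVERY NON-SPLIT PLACE PRIME TO `4d`, FOR EVERY CM FIELD**: at a place `v` of
`K⁺` above `p` with `4d ∉ v` and one prime of `K` above it, for every hermitian `H` with unit determinant good above
`v`, `ChainNumerals K v l k H q (q³ + 1) q⁴ (q⁴ + q)` with `q = p^{f(v/p)}` (file 291's `chainNumerals_of_map_eq`). -/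
theorem chainNumerals_of_four_mul_notMem (hvd : 4 * d ∉ v.asIdeal)
    (h1 : (v.asIdeal.primesOver (𝓞 K)).ncard = 1)
    {r : ℕ} (l : Fin r → 𝓞 K) (k : Type*) [Field k] [CharZero k]
    (hl : Submodule.span (𝓞 (maximalRealSubfield K)) (Set.range l) = ⊤)
    {H : Matrix (Fin 3) (Fin 3) K} (hH : H.IsHermitian) (hdet : IsUnit H.det)
    (hbad : ∀ w : HeightOneSpectrum (𝓞 K), w.asIdeal.LiesOver v.asIdeal → w ∉ badSet H) :
    ChainNumerals K v l k H (p ^ v.asIdeal.inertiaDeg ℤ) ((p ^ v.asIdeal.inertiaDeg ℤ) ^ 3 + 1)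
      ((p ^ v.asIdeal.inertiaDeg ℤ) ^ 4) ((p ^ v.asIdeal.inertiaDeg ℤ) ^ 4 + p ^ v.asIdeal.inertiaDeg ℤ) := by
  obtain ⟨w, hmap⟩ := map_eq_of_four_mul_notMem_of_ncard_eq_one K d x hdx hx v hvd h1
  exact chainNumerals_of_map_eq K v p w hmap l k hl hH hdet
    (hbad w (T5CyclotomicSevenHeckeCommutative.liesOver_of_map_eq K v w hmap)) _ _ _ _ rfl rfl rfl rfl

include hdx hx hv in
/-- The same for an integral unimodular `H = M.map ι` (file 311), no local hypothesis. -/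
theorem chainNumerals_of_four_mul_notMem_integral (hvd : 4 * d ∉ v.asIdeal)
    (h1 : (v.asIdeal.primesOver (𝓞 K)).ncard = 1)
    {r : ℕ} (l : Fin r → 𝓞 K) (k : Type*) [Field k] [CharZero k]
    (hl : Submodule.span (𝓞 (maximalRealSubfield K)) (Set.range l) = ⊤)
    (M : Matrix (Fin 3) (Fin 3) (𝓞 K)) (hM : IsUnit M.det)
    (hH : ((algebraMap (𝓞 K) K).mapMatrix M).IsHermitian) :
    ChainNumerals K v l k ((algebraMap (𝓞 K) K).mapMatrix M) (p ^ v.asIdeal.inertiaDeg ℤ)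
      ((p ^ v.asIdeal.inertiaDeg ℤ) ^ 3 + 1) ((p ^ v.asIdeal.inertiaDeg ℤ) ^ 4)
      ((p ^ v.asIdeal.inertiaDeg ℤ) ^ 4 + p ^ v.asIdeal.inertiaDeg ℤ) :=
  chainNumerals_of_four_mul_notMem K d x hdx hx p v hvd h1 l k hl hH (isUnit_det_mapMatrix M hM)
    (forall_notMem_badSet_mapMatrix v M hM)

end Summit.Ventures.HodgeRepro2.T5RecordSatakeDifferentChain
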